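import Literature.NumberTheory.IwasawaTheory.FukudaElementaryLayerAlgebra
import Literature.NumberTheory.IwasawaTheory.ClassGroupPRankSmallRankCriterion
import Literature.NumberTheory.IwasawaTheory.ClassicalLambdaLeStableRank
import Literature.NumberTheory.IwasawaTheory.ClassicalMuVanishesUnitNormIndexGenerated
import Literature.NumberTheory.IwasawaTheory.ClassicalMuVanishesReflectionLayer
import Literature.NumberTheory.IwasawaTheory.CyclotomicTwoTotallyRamifiedOddIndex
import HarnessLib

/-!
# THE ELEMENTARY-LAYER DOOR: over a base with `p ∤ h_K` and `ord_p h(K_1) ≤ 1`, ONE layer `K_k` whose `p`-class group is NOT elementary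
# abelian (`rank_p Cl(K_k) < ord_p h(K_k)` — e.g. ONE ideal class of order `p²`, or `p^{p^k} ∣ h(K_k)`) forces `rank_p Cl(K_m) ≤ p^k − 2`
# for EVERY `m`, `μ = 0` and `λ ≤ p^k − 2`; hence «`ord_p h(K_k) ≠ p^k − 1` for one `k` ⟹ `μ = 0`» (proved, finite level)

`Proofs`-style file (theorems only: no definition, no named fact, no instance, no `sorry`) in topic `NumberTheory/IwasawaTheory`
(namespace = path), written by the prover seat `bsd-line-att-p3` g47 (cell `bsd-f1-sign2`, WIDTH-5 attach on route `AlignedTransportAtTwo`;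
`--supports` stmt-BirchSwinnertonDyer-22298, closes nothing; no class group is computed here; BSD is not advanced by this file).

THE THEOREM (`classGroupPRank_le_of_classGroupPRank_lt_classNumberPExp`).  `K` a number field, `p` a prime, `κ` a `ℤ_p`-extension of `K` with
Fukuda's index `0` (`TotallyRamifiedFrom κ 0`: every ramified prime is totally ramified in `K_∞/K`), `e_j = ord_p h(K_j)`, `r_j = rank_p Cl(K_j)`.
IF `e_0 = 0` (`p ∤ h_K`), `e_1 ≤ 1`, AND `r_k < e_k` for ONE `k` — i.e. the `p`-class group `Cl(K_k)[p^∞]` is NOT elementary abelian —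
THEN **`r_m ≤ p^k − 2` for every `m`**, hence (tree: bounded ranks) **`μ = 0` and `λ ≤ p^k − 2`**
(`classicalMuVanishes_and_classicalLambda_le_of_classGroupPRank_lt_classNumberPExp`).  Readings of the hypothesis:
* `exists_orderOf_eq_sq` dictionary: **ONE class of order `p²` in `Cl(K_k)` ⟹ `r_k < e_k`** (`classGroupPRank_lt_classNumberPExp_of_orderOf_eq_sq`);
* **`p^{p^k} ∣ h(K_k)` ⟹ `r_k < e_k`**, because `r_k ≤ p^k − 1` ALWAYS holds under `e_0 = 0`, `e_1 ≤ 1` (`classGroupPRank_le_pow_sub_one`);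
* combined with the tree's door L10 (`r_k ≤ e_k ≤ p^k − 2 < p^k − 1`): ★★★ **`e_k ≠ p^k − 1` for ONE `k` ⟹ `r_m ≤ p^k − 2 ∀ m`, `μ = 0`, `λ ≤ p^k − 2`**
  (`classicalMuVanishes_and_classicalLambda_le_of_classNumberPExp_ne`).  CONTRAPOSITIVE (the census law): over such a base, `μ > 0` forces
  `ord_p h(K_k) = rank_p Cl(K_k) = p^k − 1`, i.e. `Cl(K_k)[p^∞] ≅ (ℤ/p)^{p^k−1}`, at EVERY layer `k ≥ 1`.
* `p = 2`, `K` of odd degree with `2 ∤ d_K`, `κ` cyclotomic (Fukuda index `0` is automatic, tree `totallyRamifiedFrom_zero_of_not_dvd_discr`):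
  `classicalMuVanishes_two_of_classNumberPExp_ne_of_not_dvd_discr` — **`2 ∤ h_K`, `ord₂ h(K_1) ≤ 1`, `ord₂ h(K_k) ≠ 2^k − 1` ⟹ `μ₂ = 0`, `λ₂ ≤ 2^k − 2`**;
  at `k = 2`: «`ord₂ h(K_2) ≠ 3` ⟹ `μ₂ = 0`, `λ₂ ≤ 2`, all `rank₂ ≤ 2`».

WHY (Washington §13.3 in one line: `A_0 = 0` makes `X = Λ/J` and `e_1 ≤ 1` makes `X` cyclic with `v_p(j(0)) = 1` for some `j ∈ J` unless `X` is pro-cyclic;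
`μ > 0` would mean `J = pΛ`, `A_k = 𝔽_p[T]/(T^{p^k−1})` elementary of rank `p^k − 1` at every layer; a non-elementary `A_k` exhibits `j ∉ pΛ` of Weierstrass
degree `< p^k − 1`).  At finite level: the package `exists_layer_package` (`G = Gal(H_p(K_t)/K)`, `A = Gal(H_p/K_t)`, `φ` = conjugation by a totally ramified
inertia generator, `Y₀`; `p^{e_j} = #(A/ν_jY₀)`, `p^{r_j} = #(A/(ν_jY₀ + pA))`, tree `FukudaGroup.relIndex_commutator_sup_layer{,_pow}_mul_card`), `e_0 = 0` gives
`Y₀ = A`, and the algebra brick `FukudaElementary.card_quotient_smul_le_of_card_quotient_sup_lt` (Nakayama over `ℤ[φ]`) gives `#(A/pA) ≤ p^{p^k−2}`.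

COMPARISON.  Every one-layer door of the tree reads a RANK (L10 `r_k < p^k − 1`, L11 central, L12 coinvariant, the rank-jump door `r_k − r_j < p^k − p^j`,
Fukuda `r_{n+1} = r_n`) or a CARD EQUALITY (Fukuda `e_{n+1} = e_n`, the unit doors); this door reads the EXPONENT (`e_k ≠ r_k`), whose certificate
is of LOWER-BOUND type: one non-principal ideal whose `p`-th power is principal but which is not itself a `p`-th power class — no upper bound on a class
group is needed.  Logically `r_k < e_k ⟹ r_k ≤ p^k − 2` (this file) so L10 also fires, but L10's INPUT `r_k` is the full `p`-rank.
Not found in print in this form (presearch: corpus hybrid/vsearch — Lang 1990 Ch. 13 §4, Washington §13.3; galaxy — none); ingredients cited at each use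
(D-0014: our proof of a statement assembled from cited ingredients).

References: [Washington1997] L. Washington, *Introduction to Cyclotomic Fields*, 2nd ed., §13.3 Lemmas 13.15, 13.18, Prop. 13.22–13.23;
[Fukuda1994] T. Fukuda, *Remarks on ℤ_p-extensions of number fields*, Proc. Japan Acad. 70 A (1994), Thm. 1 and its proof, p. 264;
[Lang1990] S. Lang, *Cyclotomic Fields I and II*, Ch. 5 §1–§2, Ch. 13 §4.
-/

set_option autoImplicit false

noncomputable section

open scoped NumberField IsMulCommutative
open NumberField Field Finset

namespace Literature.NumberTheory.IwasawaTheory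

open Literature.NumberTheory.EllipticCurves

variable {K : Type} [Field K] [NumberField K] {p : ℕ} [hp : Fact p.Prime]

/-! ## §1 Inside the package -/

/-- The finite-level step: in the package of `K ⊆ K_t ⊆ H_p(K_t)` (`t = m + k + 1`), `e_0 = 0`, `e_1 ≤ 1` and `r_k < e_k` give
`r_m ≤ p^k − 2`. [cite: Washington1997, §13.3 Lemmas 13.15, 13.18 and Prop. 13.22] [cite: Fukuda1994, Thm. 1 (proof, p. 264)] -/
private theorem layer_not_elementary (κ : ZpExtension K p) (hκ : TotallyRamifiedFrom κ 0) (h0 : classNumberPExp κ 0 = 0)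
    (h1 : classNumberPExp κ 1 ≤ 1) {k : ℕ} (hk : classGroupPRank κ k < classNumberPExp κ k) (m : ℕ) :
    classGroupPRank κ m ≤ p ^ k - 2 := by
  classical
  have hp1 : 1 < p := hp.out.one_lt
  set t := m + k + 1 with ht_def
  have ht : 1 ≤ t := by omega
  obtain ⟨G, _instG, _instF, A', hA'n, _instC, g, 𝓘, hgA, hgen, hA'index, h𝓘, hg𝓘, hA'card, hlayer⟩ :=
    exists_layer_package κ hκ (le_refl 0) t ht
  simp only [Nat.zero_add] at hlayer hA'card
  set Y : Submodule ℤ (Additive A') := FukudaGroup.subOf A' (⁅(⊤ : Subgroup G), ⊤⁆ ⊔ ⨆ I ∈ 𝓘, I) with hY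
  set φ : Module.End ℤ (Additive A') := FukudaGroup.conjEnd A' g with hφ
  set P : Submodule ℤ (Additive A') := (⊤ : Submodule ℤ (Additive A')).map ((p : ℤ) • (1 : Module.End ℤ (Additive A')))
    with hP
  have hφt : φ ^ p ^ t = 1 := FukudaGroup.conjEnd_pow_index_eq_one hgA hgen hA'index
  have hM : ∃ a : ℕ, Nat.card (Additive A') = p ^ a := ⟨_, hA'card⟩
  -- `#(A/ν_i Y) = p^{e_i}` and `#(A/(ν_i Y + pA)) = p^{r_i}`
  have hquotE : ∀ {i : ℕ} (_ : i ≤ t) {Gi : Subgroup G} (_ : A' ≤ Gi) (_ : Gi.index = p ^ i),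
      (⁅Gi, Gi⁆ ⊔ ⨆ I ∈ 𝓘, I ⊓ Gi).relIndex Gi = Nat.card (Additive A' ⧸ Y.map (∑ l ∈ range (p ^ i), φ ^ l)) := by
    intro i hi Gi hAGi hGi
    have hmul := FukudaGroup.relIndex_commutator_sup_layer_mul_card hgA hgen hA'index h𝓘 hg𝓘 hi hAGi hGi
    have hcard : Nat.card A' = Nat.card ↥(Y.map (∑ l ∈ range (p ^ i), φ ^ l)) *
        Nat.card (Additive A' ⧸ Y.map (∑ l ∈ range (p ^ i), φ ^ l)) :=
      Submodule.card_eq_card_quotient_mul_card (Y.map (∑ l ∈ range (p ^ i), φ ^ l))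
    rw [hcard, mul_comm (Nat.card ↥(Y.map _))] at hmul
    exact Nat.eq_of_mul_eq_mul_right Nat.card_pos hmul
  have hquotR : ∀ {i : ℕ} (_ : i ≤ t) {Gi : Subgroup G} (_ : A' ≤ Gi) (_ : Gi.index = p ^ i),
      ((⁅Gi, Gi⁆ ⊔ ⨆ I ∈ 𝓘, I ⊓ Gi) ⊔ Subgroup.closure ((fun x : G => x ^ p) '' (Gi : Set G))).relIndex Gi =
        Nat.card (Additive A' ⧸ (Y.map (∑ l ∈ range (p ^ i), φ ^ l) ⊔ P)) := by
    intro i hi Gi hAGi hGi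
    have hmul := FukudaGroup.relIndex_commutator_sup_layer_pow_mul_card hgA hgen hA'index h𝓘 hg𝓘 hi hAGi hGi
    have hcard : Nat.card A' = Nat.card ↥(Y.map (∑ l ∈ range (p ^ i), φ ^ l) ⊔ P) *
        Nat.card (Additive A' ⧸ (Y.map (∑ l ∈ range (p ^ i), φ ^ l) ⊔ P)) :=
      Submodule.card_eq_card_quotient_mul_card (Y.map (∑ l ∈ range (p ^ i), φ ^ l) ⊔ P)
    rw [hcard, mul_comm (Nat.card ↥(Y.map _ ⊔ P))] at hmul
    exact Nat.eq_of_mul_eq_mul_right Nat.card_pos hmul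
  -- `Y = A` from `e_0 = 0`
  obtain ⟨G0, hAG0, hG0, he0, -⟩ := hlayer 0 (Nat.zero_le _)
  have hYtop : Y = ⊤ := by
    have h := hquotE (Nat.zero_le _) hAG0 hG0
    rw [he0, h0, pow_zero, range_one, sum_singleton, pow_zero, Module.End.one_eq_id, Submodule.map_id] at h
    haveI : Finite (Additive A' ⧸ (⊤ : Submodule ℤ (Additive A'))) := Finite.of_surjective _ (Submodule.Quotient.mk_surjective _)
    exact FukudaElementary.eq_of_le_of_card_quotient_le le_top (by rw [← h]; exact Nat.card_pos)
  -- the three layers `1`, `k`, `m`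
  obtain ⟨G1, hAG1, hG1, he1, -⟩ := hlayer 1 ht
  obtain ⟨Gk, hAGk, hGk, hek, hrk⟩ := hlayer k (by omega)
  obtain ⟨Gm, hAGm, hGm, -, hrm⟩ := hlayer m (by omega)
  have h1' : Nat.card (Additive A' ⧸ (⊤ : Submodule ℤ (Additive A')).map (∑ l ∈ range p, φ ^ l)) ≤ p := by
    have h := hquotE ht hAG1 hG1
    rw [he1, hYtop, pow_one] at h
    rw [← h]
    calc p ^ classNumberPExp κ 1 ≤ p ^ 1 := Nat.pow_le_pow_right hp.out.pos h1
      _ = p := pow_one p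
  have hk' : Nat.card (Additive A' ⧸ ((⊤ : Submodule ℤ (Additive A')).map (∑ l ∈ range (p ^ k), φ ^ l) ⊔ P)) <
      Nat.card (Additive A' ⧸ (⊤ : Submodule ℤ (Additive A')).map (∑ l ∈ range (p ^ k), φ ^ l)) := by
    have hE := hquotE (by omega) hAGk hGk
    have hR := hquotR (by omega) hAGk hGk
    rw [hYtop] at hE hR
    rw [← hE, ← hR, hek, hrk]
    exact Nat.pow_lt_pow_right hp1 hk
  have hbound := FukudaElementary.card_quotient_smul_le_of_card_quotient_sup_lt hM φ hφt h1' hk'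
  have hrm' : p ^ classGroupPRank κ m ≤ p ^ (p ^ k - 2) := by
    have hR := hquotR (by omega) hAGm hGm
    rw [hYtop, hrm] at hR
    rw [hR]
    exact (MuZeroRank.card_quotient_le_of_le le_sup_right).trans hbound
  exact (Nat.pow_le_pow_iff_right hp1).mp hrm'

/-- In the same package: `e_0 = 0` and `e_1 ≤ 1` alone give `r_m ≤ p^m − 1` for every `m` (the layer module is cyclic over `ℤ[φ]`).
[cite: Washington1997, §13.3 Lemma 13.18 and Prop. 13.23 (proof)] [cite: Fukuda1994, Thm. 1 (proof, p. 264)] -/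
private theorem layer_rank_le (κ : ZpExtension K p) (hκ : TotallyRamifiedFrom κ 0) (h0 : classNumberPExp κ 0 = 0)
    (h1 : classNumberPExp κ 1 ≤ 1) (m : ℕ) : classGroupPRank κ m ≤ p ^ m - 1 := by
  classical
  have hp1 : 1 < p := hp.out.one_lt
  set t := m + 1 with ht_def
  have ht : 1 ≤ t := by omega
  obtain ⟨G, _instG, _instF, A', hA'n, _instC, g, 𝓘, hgA, hgen, hA'index, h𝓘, hg𝓘, hA'card, hlayer⟩ :=
    exists_layer_package κ hκ (le_refl 0) t ht
  simp only [Nat.zero_add] at hlayer hA'card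
  set Y : Submodule ℤ (Additive A') := FukudaGroup.subOf A' (⁅(⊤ : Subgroup G), ⊤⁆ ⊔ ⨆ I ∈ 𝓘, I) with hY
  set φ : Module.End ℤ (Additive A') := FukudaGroup.conjEnd A' g with hφ
  set P : Submodule ℤ (Additive A') := (⊤ : Submodule ℤ (Additive A')).map ((p : ℤ) • (1 : Module.End ℤ (Additive A')))
    with hP
  have hquotE : ∀ {i : ℕ} (_ : i ≤ t) {Gi : Subgroup G} (_ : A' ≤ Gi) (_ : Gi.index = p ^ i),
      (⁅Gi, Gi⁆ ⊔ ⨆ I ∈ 𝓘, I ⊓ Gi).relIndex Gi = Nat.card (Additive A' ⧸ Y.map (∑ l ∈ range (p ^ i), φ ^ l)) := by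
    intro i hi Gi hAGi hGi
    have hmul := FukudaGroup.relIndex_commutator_sup_layer_mul_card hgA hgen hA'index h𝓘 hg𝓘 hi hAGi hGi
    have hcard : Nat.card A' = Nat.card ↥(Y.map (∑ l ∈ range (p ^ i), φ ^ l)) *
        Nat.card (Additive A' ⧸ Y.map (∑ l ∈ range (p ^ i), φ ^ l)) :=
      Submodule.card_eq_card_quotient_mul_card (Y.map (∑ l ∈ range (p ^ i), φ ^ l))
    rw [hcard, mul_comm (Nat.card ↥(Y.map _))] at hmul
    exact Nat.eq_of_mul_eq_mul_right Nat.card_pos hmul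
  have hquotR : ∀ {i : ℕ} (_ : i ≤ t) {Gi : Subgroup G} (_ : A' ≤ Gi) (_ : Gi.index = p ^ i),
      ((⁅Gi, Gi⁆ ⊔ ⨆ I ∈ 𝓘, I ⊓ Gi) ⊔ Subgroup.closure ((fun x : G => x ^ p) '' (Gi : Set G))).relIndex Gi =
        Nat.card (Additive A' ⧸ (Y.map (∑ l ∈ range (p ^ i), φ ^ l) ⊔ P)) := by
    intro i hi Gi hAGi hGi
    have hmul := FukudaGroup.relIndex_commutator_sup_layer_pow_mul_card hgA hgen hA'index h𝓘 hg𝓘 hi hAGi hGi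
    have hcard : Nat.card A' = Nat.card ↥(Y.map (∑ l ∈ range (p ^ i), φ ^ l) ⊔ P) *
        Nat.card (Additive A' ⧸ (Y.map (∑ l ∈ range (p ^ i), φ ^ l) ⊔ P)) :=
      Submodule.card_eq_card_quotient_mul_card (Y.map (∑ l ∈ range (p ^ i), φ ^ l) ⊔ P)
    rw [hcard, mul_comm (Nat.card ↥(Y.map _ ⊔ P))] at hmul
    exact Nat.eq_of_mul_eq_mul_right Nat.card_pos hmul
  obtain ⟨G0, hAG0, hG0, he0, -⟩ := hlayer 0 (Nat.zero_le _)
  have hYtop : Y = ⊤ := by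
    have h := hquotE (Nat.zero_le _) hAG0 hG0
    rw [he0, h0, pow_zero, range_one, sum_singleton, pow_zero, Module.End.one_eq_id, Submodule.map_id] at h
    haveI : Finite (Additive A' ⧸ (⊤ : Submodule ℤ (Additive A'))) := Finite.of_surjective _ (Submodule.Quotient.mk_surjective _)
    exact FukudaElementary.eq_of_le_of_card_quotient_le le_top (by rw [← h]; exact Nat.card_pos)
  obtain ⟨G1, hAG1, hG1, he1, -⟩ := hlayer 1 ht
  obtain ⟨Gm, hAGm, hGm, -, hrm⟩ := hlayer m (by omega)
  have h1' : Nat.card (Additive A' ⧸ (⊤ : Submodule ℤ (Additive A')).map (∑ l ∈ range p, φ ^ l)) ≤ p := by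
    have h := hquotE ht hAG1 hG1
    rw [he1, hYtop, pow_one] at h
    rw [← h]
    calc p ^ classNumberPExp κ 1 ≤ p ^ 1 := Nat.pow_le_pow_right hp.out.pos h1
      _ = p := pow_one p
  have hbound := FukudaElementary.card_quotient_sup_le_pow φ h1' m
  have hR := hquotR (by omega) hAGm hGm
  rw [hYtop, hrm] at hR
  rw [← hR] at hbound
  exact (Nat.pow_le_pow_iff_right hp1).mp hbound

/-! ## §2 The door along the tower -/

/-- ★★★ **THE ELEMENTARY-LAYER DOOR.**  `κ` a `ℤ_p`-extension of the number field `K` with Fukuda index `0`, `p ∤ h_K` (`e_0 = 0`),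
`ord_p h(K_1) ≤ 1`: if the `p`-class group of ONE layer `K_k` is NOT elementary abelian — `rank_p Cl(K_k) < ord_p h(K_k)` — then
**`rank_p Cl(K_m) ≤ p^k − 2` for every `m`**. [cite: Washington1997, §13.3 Lemma 13.18 and Prop. 13.22–13.23] [cite: Fukuda1994, Thm. 1 (proof, p. 264)] -/
theorem classGroupPRank_le_of_classGroupPRank_lt_classNumberPExp (κ : ZpExtension K p) (hκ : TotallyRamifiedFrom κ 0)
    (h0 : classNumberPExp κ 0 = 0) (h1 : classNumberPExp κ 1 ≤ 1) {k : ℕ} (hk : classGroupPRank κ k < classNumberPExp κ k) (m : ℕ) :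
    classGroupPRank κ m ≤ p ^ k - 2 :=
  layer_not_elementary κ hκ h0 h1 hk m

/-- **`μ = 0` and `λ ≤ p^k − 2` from one non-elementary layer** (growth form; tree «bounded ranks ⟹ `μ = 0`, `λ ≤` the bound»).
[cite: Washington1997, §13.3 Prop. 13.23] [cite: Fukuda1994, Thm. 1 (2), p. 264] -/
theorem classicalMuVanishes_and_classicalLambda_le_of_classGroupPRank_lt_classNumberPExp (κ : ZpExtension K p)
    (hκ : TotallyRamifiedFrom κ 0) (h0 : classNumberPExp κ 0 = 0) (h1 : classNumberPExp κ 1 ≤ 1) {k : ℕ}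
    (hk : classGroupPRank κ k < classNumberPExp κ k) : ClassicalMuVanishes κ ∧ classicalLambda κ ≤ p ^ k - 2 :=
  classicalLambda_le_of_forall_classGroupPRank_le κ hκ (le_refl 0)
    fun m _ => classGroupPRank_le_of_classGroupPRank_lt_classNumberPExp κ hκ h0 h1 hk m

/-- The hypothesis with `≠` instead of `<` (`r_k ≤ e_k` always, tree `classGroupPRank_le_classNumberPExp`). [cite: Fukuda1994, Thm. 1 (proof, p. 264)] -/
theorem classGroupPRank_le_of_classGroupPRank_ne_classNumberPExp (κ : ZpExtension K p) (hκ : TotallyRamifiedFrom κ 0)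
    (h0 : classNumberPExp κ 0 = 0) (h1 : classNumberPExp κ 1 ≤ 1) {k : ℕ} (hk : classGroupPRank κ k ≠ classNumberPExp κ k) (m : ℕ) :
    classGroupPRank κ m ≤ p ^ k - 2 :=
  classGroupPRank_le_of_classGroupPRank_lt_classNumberPExp κ hκ h0 h1
    (lt_of_le_of_ne (classGroupPRank_le_classNumberPExp κ k) hk) m

/-- **The ranks are at most `p^m − 1`**: `p ∤ h_K`, Fukuda index `0` and `ord_p h(K_1) ≤ 1` give `rank_p Cl(K_m) ≤ p^m − 1` for every `m`
(the layer module is cyclic over `ℤ[φ]`, so `A_m/p` is a quotient of `𝔽_p[T]/(T^{p^m−1})`). [cite: Washington1997, §13.3 Prop. 13.23 (proof)] -/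
theorem classGroupPRank_le_pow_sub_one (κ : ZpExtension K p) (hκ : TotallyRamifiedFrom κ 0) (h0 : classNumberPExp κ 0 = 0)
    (h1 : classNumberPExp κ 1 ≤ 1) (m : ℕ) : classGroupPRank κ m ≤ p ^ m - 1 :=
  layer_rank_le κ hκ h0 h1 m

/-- **`p^{p^k} ∣ h(K_k)` ⟹ the door fires**: `e_k ≥ p^k > p^k − 1 ≥ r_k`, so `rank_p Cl(K_m) ≤ p^k − 2` for every `m`, `μ = 0`, `λ ≤ p^k − 2` — a
class-number LOWER BOUND at one layer as the only datum beyond `e_0 = 0`, `e_1 ≤ 1`. [cite: Washington1997, §13.3 Prop. 13.22–13.23] [cite: Fukuda1994, Thm. 1, p. 264] -/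
theorem classicalMuVanishes_and_classicalLambda_le_of_pow_le_classNumberPExp (κ : ZpExtension K p) (hκ : TotallyRamifiedFrom κ 0)
    (h0 : classNumberPExp κ 0 = 0) (h1 : classNumberPExp κ 1 ≤ 1) {k : ℕ} (hk : p ^ k ≤ classNumberPExp κ k) :
    (∀ m, classGroupPRank κ m ≤ p ^ k - 2) ∧ ClassicalMuVanishes κ ∧ classicalLambda κ ≤ p ^ k - 2 := by
  have hlt : classGroupPRank κ k < classNumberPExp κ k := by
    have h := classGroupPRank_le_pow_sub_one κ hκ h0 h1 k
    have : 1 ≤ p ^ k := Nat.one_le_pow _ _ hp.out.pos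
    omega
  exact ⟨classGroupPRank_le_of_classGroupPRank_lt_classNumberPExp κ hκ h0 h1 hlt,
    classicalMuVanishes_and_classicalLambda_le_of_classGroupPRank_lt_classNumberPExp κ hκ h0 h1 hlt⟩

/-- ★★★ **THE CLASS-NUMBER TEST.**  `p ∤ h_K`, Fukuda index `0`, `ord_p h(K_1) ≤ 1`: **`ord_p h(K_k) ≠ p^k − 1` for ONE `k` ⟹ `rank_p Cl(K_m) ≤ p^k − 2`
for every `m`, `μ = 0` and `λ ≤ p^k − 2`** — below `p^k − 1` the small-rank door L10 of the tree fires (`r_k ≤ e_k ≤ p^k − 2 < p^k − 1`), above it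
the elementary-layer door.  Equivalently: `μ > 0` forces `ord_p h(K_k) = p^k − 1` at EVERY layer. [cite: Washington1997, §13.3 Prop. 13.22–13.23]
[cite: Fukuda1994, Thm. 1 and its proof, p. 264] -/
theorem classicalMuVanishes_and_classicalLambda_le_of_classNumberPExp_ne (κ : ZpExtension K p) (hκ : TotallyRamifiedFrom κ 0)
    (h0 : classNumberPExp κ 0 = 0) (h1 : classNumberPExp κ 1 ≤ 1) {k : ℕ} (hk : classNumberPExp κ k ≠ p ^ k - 1) :
    (∀ m, classGroupPRank κ m ≤ p ^ k - 2) ∧ ClassicalMuVanishes κ ∧ classicalLambda κ ≤ p ^ k - 2 := by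
  rcases lt_or_gt_of_ne hk with hlt | hgt
  · -- `e_k ≤ p^k - 2`: door L10 at `j = k`, `n = 0`
    have hsmall : classGroupPRank κ (0 + k) < p ^ k - 1 := by
      rw [Nat.zero_add]; exact lt_of_le_of_lt (classGroupPRank_le_classNumberPExp κ k) hlt
    have hbound : ∀ m, classGroupPRank κ m ≤ p ^ k - 2 := by
      intro m
      have h := classGroupPRank_le_of_lt_pow_sub_one κ hκ (le_refl 0) hsmall m
      rw [Nat.zero_add, Nat.zero_add] at h
      have h' := classGroupPRank_le_classNumberPExp κ k
      omega
    exact ⟨hbound, classicalLambda_le_of_forall_classGroupPRank_le κ hκ (le_refl 0) fun m _ => hbound m⟩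
  · exact classicalMuVanishes_and_classicalLambda_le_of_pow_le_classNumberPExp κ hκ h0 h1 (by omega)

/-! ## §3 The dictionary «one class of order `p²`» and the packagings -/

omit [NumberField K] hp in
/-- **ONE class of order `p²` in `Cl(K_k)` makes `Cl(K_k)[p^∞]` non-elementary: `rank_p Cl(K_k) < ord_p h(K_k)`** (the subgroup of classes killed by
`p²` is a `p`-group strictly larger than `Cl(K_k)[p]`, of order `p^{r_k}`, and its order divides the `p`-part `p^{e_k}` of `h(K_k)`).
[cite: Fukuda1994, p. 264 (definition of `rank(M)` and `|A_n|`)] -/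
theorem classGroupPRank_lt_classNumberPExp_of_orderOf_eq_sq [NumberField K] [hp : Fact p.Prime] (κ : ZpExtension K p) {k : ℕ}
    {c : ClassGroup (𝓞 (κ.layer k))} (hc : orderOf c = p ^ 2) : classGroupPRank κ k < classNumberPExp κ k := by
  classical
  haveI : FiniteDimensional K (κ.layer k) := κ.finiteDimensional_layer_holds k
  haveI : NumberField (κ.layer k) := NumberField.of_module_finite K _
  -- the `p`-torsion has order `p^{r_k}`
  have htor := natCard_torsion_classGroup_layer_eq κ k
  -- the `p²`-torsion subgroup
  set H : Subgroup (ClassGroup (𝓞 (κ.layer k))) :=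
    (powMonoidHom (p ^ 2) : ClassGroup (𝓞 (κ.layer k)) →* ClassGroup (𝓞 (κ.layer k))).ker with hH
  have hmemH : ∀ x : ClassGroup (𝓞 (κ.layer k)), x ∈ H ↔ x ^ (p ^ 2) = 1 := fun x => by
    rw [hH, MonoidHom.mem_ker, powMonoidHom_apply]
  have hHp : IsPGroup p H := by
    intro x
    refine ⟨2, ?_⟩
    have hx := (hmemH x).mp x.2
    exact Subtype.ext (by rw [Subgroup.coe_pow, hx, Subgroup.coe_one])
  obtain ⟨s, hs⟩ := hHp.exists_card_eq
  -- `#H ∣ h(K_k)`, so `s ≤ e_k`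
  have hsdvd : p ^ s ∣ Nat.card (ClassGroup (𝓞 (κ.layer k))) := by rw [← hs]; exact Subgroup.card_subgroup_dvd_card H
  have hse : s ≤ classNumberPExp κ k := by
    rw [classNumberPExp_def]
    exact (padicValNat_dvd_iff_le Nat.card_pos.ne').mp hsdvd
  -- `Cl[p] ⊊ H`: `c ∈ H`, `c ∉ Cl[p]`
  have hcH : c ∈ H := (hmemH c).mpr (by rw [← hc]; exact pow_orderOf_eq_one c)
  have hcp : c ^ p ≠ 1 := by
    intro h
    have h1 : orderOf c ∣ p := orderOf_dvd_of_pow_eq_one h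
    rw [hc] at h1
    have h2 : p ^ 2 ≤ p ^ 1 := by rw [pow_one]; exact Nat.le_of_dvd hp.out.pos h1
    have h3 := (Nat.pow_le_pow_iff_right hp.out.one_lt).mp h2
    omega
  -- the injection `Cl[p] ↪ H` is not surjective
  let ι : {x : ClassGroup (𝓞 (κ.layer k)) // x ^ p = 1} → H := fun x => ⟨x.1, (hmemH _).mpr (by rw [pow_succ, pow_one, pow_mul, x.2, one_pow])⟩
  have hι : Function.Injective ι := fun x y hxy => Subtype.ext (by simpa [ι] using congrArg Subtype.val hxy)
  have hlt : Nat.card {x : ClassGroup (𝓞 (κ.layer k)) // x ^ p = 1} < Nat.card H := by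
    refine lt_of_le_of_ne (Nat.card_le_card_of_injective ι hι) fun heq => hcp ?_
    have hbij : Function.Bijective ι := by
      rw [Nat.bijective_iff_injective_and_card]; exact ⟨hι, heq⟩
    obtain ⟨x, hx⟩ := hbij.2 ⟨c, hcH⟩
    have : (x : ClassGroup (𝓞 (κ.layer k))) = c := congrArg Subtype.val hx
    rw [← this]; exact x.2
  rw [htor, hs] at hlt
  exact lt_of_lt_of_le ((Nat.pow_lt_pow_iff_right hp.out.one_lt).mp hlt) hse

/-- The door from ONE class of order `p²`: `p ∤ h_K`, Fukuda index `0`, `ord_p h(K_1) ≤ 1`, `c ∈ Cl(K_k)` of order `p²` ⟹ `rank_p Cl(K_m) ≤ p^k − 2 ∀ m`,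
`μ = 0`, `λ ≤ p^k − 2`. [cite: Washington1997, §13.3 Prop. 13.22–13.23] [cite: Fukuda1994, Thm. 1, p. 264] -/
theorem classicalMuVanishes_and_classicalLambda_le_of_orderOf_eq_sq (κ : ZpExtension K p) (hκ : TotallyRamifiedFrom κ 0)
    (h0 : classNumberPExp κ 0 = 0) (h1 : classNumberPExp κ 1 ≤ 1) {k : ℕ} {c : ClassGroup (𝓞 (κ.layer k))} (hc : orderOf c = p ^ 2) :
    (∀ m, classGroupPRank κ m ≤ p ^ k - 2) ∧ ClassicalMuVanishes κ ∧ classicalLambda κ ≤ p ^ k - 2 :=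
  have hk := classGroupPRank_lt_classNumberPExp_of_orderOf_eq_sq κ hc
  ⟨classGroupPRank_le_of_classGroupPRank_lt_classNumberPExp κ hκ h0 h1 hk,
    classicalMuVanishes_and_classicalLambda_le_of_classGroupPRank_lt_classNumberPExp κ hκ h0 h1 hk⟩

/-- `e_0 = 0` from `p ∤ h_K` (the layer `K_0` is `K`; tree `classNumberPExp_zero_eq_padicValNat_classNumber`).
[cite: Fukuda1994, Thm. 1, p. 264 (the base layer `k = k_{n₀}`)] -/
theorem classNumberPExp_zero_eq_zero_of_not_dvd (κ : ZpExtension K p) (hK : ¬ p ∣ classNumber K) : classNumberPExp κ 0 = 0 := by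
  rw [classNumberPExp_zero_eq_padicValNat_classNumber]
  exact padicValNat.eq_zero_of_not_dvd hK

/-- **`p = 2` packaging** for a field `K` of ODD degree with ODD discriminant and a cyclotomic `ℤ₂`-extension `κ` (Fukuda index `0` is automatic,
tree `totallyRamifiedFrom_zero_of_not_dvd_discr`): **`2 ∤ h_K`, `ord₂ h(K_1) ≤ 1`, `ord₂ h(K_k) ≠ 2^k − 1` ⟹ `rank₂ Cl(K_m) ≤ 2^k − 2 ∀ m`, `μ₂ = 0`,
`λ₂ ≤ 2^k − 2`** — at `k = 2` (cell bsd-f1-sign2, hard core of the cubic `2`-division fields: `t = 3 ∧ e_1 = 1`): «`ord₂ h(K_2) ≠ 3` ⟹ `μ₂ = 0`, `λ₂ ≤ 2`».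
[cite: Washington1997, §13.1 Prop. 13.2, §13.3 Prop. 13.22–13.23] [cite: Fukuda1994, Thm. 1, p. 264] -/
theorem classicalMuVanishes_two_of_classNumberPExp_ne_of_not_dvd_discr (hK : ¬ 2 ∣ Module.finrank ℚ K)
    (hd : ¬ (2 : ℤ) ∣ NumberField.discr K) (hh : ¬ 2 ∣ classNumber K) (κ : ZpExtension K 2) (hκ : κ.IsCyclotomic)
    (h1 : classNumberPExp κ 1 ≤ 1) {k : ℕ} (hk : classNumberPExp κ k ≠ 2 ^ k - 1) :
    (∀ m, classGroupPRank κ m ≤ 2 ^ k - 2) ∧ ClassicalMuVanishes κ ∧ classicalLambda κ ≤ 2 ^ k - 2 :=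
  haveI : Fact (Nat.Prime 2) := ⟨Nat.prime_two⟩
  classicalMuVanishes_and_classicalLambda_le_of_classNumberPExp_ne κ (totallyRamifiedFrom_zero_of_not_dvd_discr hK hd κ hκ)
    (classNumberPExp_zero_eq_zero_of_not_dvd κ hh) h1 hk

/-- `p = 2` packaging of the order-`4` form: **`2 ∤ h_K`, odd degree, `2 ∤ d_K`, `κ` cyclotomic, `ord₂ h(K_1) ≤ 1`, ONE class of order `4` in `Cl(K_k)` ⟹
`rank₂ Cl(K_m) ≤ 2^k − 2 ∀ m`, `μ₂ = 0`, `λ₂ ≤ 2^k − 2`**. [cite: Washington1997, §13.3 Prop. 13.22–13.23] [cite: Fukuda1994, Thm. 1, p. 264] -/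
theorem classicalMuVanishes_two_of_orderOf_eq_four_of_not_dvd_discr (hK : ¬ 2 ∣ Module.finrank ℚ K)
    (hd : ¬ (2 : ℤ) ∣ NumberField.discr K) (hh : ¬ 2 ∣ classNumber K) (κ : ZpExtension K 2) (hκ : κ.IsCyclotomic)
    (h1 : classNumberPExp κ 1 ≤ 1) {k : ℕ} {c : ClassGroup (𝓞 (κ.layer k))} (hc : orderOf c = 4) :
    (∀ m, classGroupPRank κ m ≤ 2 ^ k - 2) ∧ ClassicalMuVanishes κ ∧ classicalLambda κ ≤ 2 ^ k - 2 :=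
  haveI : Fact (Nat.Prime 2) := ⟨Nat.prime_two⟩
  classicalMuVanishes_and_classicalLambda_le_of_orderOf_eq_sq κ (totallyRamifiedFrom_zero_of_not_dvd_discr hK hd κ hκ)
    (classNumberPExp_zero_eq_zero_of_not_dvd κ hh) h1 (by rw [hc]; norm_num)

end Literature.NumberTheory.IwasawaTheory

end
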